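import Mathlib.MeasureTheory.Integral.Bochner.ContinuousLinearMap
import Mathlib.MeasureTheory.Measure.Lebesgue.EqHaar
import Mathlib.Analysis.InnerProductSpace.EuclideanDist
import Literature.Analysis.FluidPDE.AxisymmetricEuler
import HarnessLib

/-!
# A square-integrable Lipschitz field vanishes at infinity

Analysis/FluidPDE support file (all results proved, no definitions) on the decomposition path of
`Literature.Analysis.FluidPDE.MajdaBertozzi2002_holderEulerUniqueness` (`ElgindiAprioriBlowupProofs.lean`):
the slices of a solution in the Hölder class `IsHolderEulerSolution` are `C^{1,γ}` with bounded
gradient and finite energy, and the Biot–Savart representation `u = K₃ * curl u`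
(`biotSavart_curl_eq_self`, `Vorticity.lean`) asks for `u → 0` at infinity. This is the
elementary bridge:

* `tendsto_cocompact_of_lipschitzWith_of_integrable_sq`: a Lipschitz map `v : E → F` on a
  finite-dimensional real inner product space with `∫ ‖v‖² < ∞` tends to `0` along the cocompact
  filter. (If `‖v(x₀)‖ ≥ ε` then `‖v‖ ≥ ε/2` on the ball `B(x₀, ε/(2L+2))`, whose contribution
  to the energy is bounded below by a fixed positive number, while `∫_{B(x₀,r)} ‖v‖² → 0` as
  `x₀ → ∞` by dominated convergence.)
* `MemC1Holder.tendsto_cocompact_of_hasFiniteEnergy`: the version for the tree's slice classes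
  `MemC1Holder γ v` (`C¹`, `v` and `Dv` bounded, `Dv` Hölder) and `HasFiniteEnergy v`
  (`∫⁻ ‖v‖ₑ² < ∞`) on `ℝ³`.

[folklore] real analysis; no single source (cf. Majda–Bertozzi, §3.1.3, p. 80: finite-energy
velocities in three dimensions decay at infinity).
-/

noncomputable section

open MeasureTheory Set Filter Topology Function Metric
open scoped ENNReal NNReal

namespace Literature.Analysis.FluidPDE

section General

variable {E : Type*} [NormedAddCommGroup E] [InnerProductSpace ℝ E] [FiniteDimensional ℝ E]
  [MeasurableSpace E] [BorelSpace E]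
variable {F : Type*} [NormedAddCommGroup F]

omit [MeasurableSpace E] [BorelSpace E] in
/-- The cocompact filter of a finite-dimensional real normed space is countably generated
(it is `comap ‖·‖ atTop`). [folklore] -/
theorem isCountablyGenerated_cocompact : (cocompact E).IsCountablyGenerated := by
  have : (cocompact E) = comap norm atTop := by
    rw [comap_norm_atTop, Metric.cobounded_eq_cocompact]
  rw [this]
  infer_instance

/-- **Tails of an integrable function over moving balls vanish**: for `g ∈ L¹(E)` and `r > 0`,
`∫_{B(x₀, r)} g → 0` as `x₀ → ∞` (dominated convergence: the indicator of `B(x₀, r)` tends to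
`0` pointwise). [folklore] -/
theorem tendsto_setIntegral_ball_cocompact {g : E → ℝ} (hg : Integrable g) (r : ℝ) :
    Tendsto (fun x₀ => ∫ x in ball x₀ r, g x) (cocompact E) (𝓝 0) := by
  haveI := isCountablyGenerated_cocompact (E := E)
  have h0 : (0 : ℝ) = ∫ _ : E, (0 : ℝ) := by simp
  rw [h0]
  simp_rw [← integral_indicator measurableSet_ball]
  refine tendsto_integral_filter_of_dominated_convergence (fun x => ‖g x‖) ?_ ?_ hg.norm ?_
  · exact Eventually.of_forall fun x₀ => (hg.indicator measurableSet_ball).aestronglyMeasurable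
  · refine Eventually.of_forall fun x₀ => Eventually.of_forall fun x => ?_
    rw [norm_indicator_eq_indicator_norm]
    exact indicator_le_self' (fun _ _ => norm_nonneg _) x
  · refine Eventually.of_forall fun x => ?_
    -- eventually `x ∉ B(x₀, r)`, so the indicator vanishes
    have hev : ∀ᶠ x₀ in cocompact E, (ball x₀ r).indicator g x = 0 := by
      have h1 : ∀ᶠ x₀ in cocompact E, r ≤ dist x₀ x :=
        (tendsto_dist_right_cocompact_atTop x).eventually (eventually_ge_atTop r)
      filter_upwards [h1] with x₀ hx₀
      rw [indicator_of_notMem]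
      rw [mem_ball, not_lt, dist_comm]
      exact hx₀
    exact tendsto_const_nhds.congr' (hev.mono fun x₀ h => h.symm)

/-- **A square-integrable Lipschitz map vanishes at infinity.** If `v : E → F` is `L`-Lipschitz and
`∫ ‖v‖² < ∞` then `v → 0` along the cocompact filter: were `‖v(x₀)‖ ≥ ε`, then `‖v‖ ≥ ε/2` on
`B(x₀, r)`, `r = ε/(2L+2)`, so `∫_{B(x₀,r)} ‖v‖² ≥ (ε/2)² |B(0, r)| > 0`, which fails for `x₀`
large by the previous lemma. [folklore] -/
theorem tendsto_cocompact_of_lipschitzWith_of_integrable_sq {v : E → F} {L : ℝ≥0}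
    (hL : LipschitzWith L v) (hint : Integrable fun x => ‖v x‖ ^ 2) :
    Tendsto v (cocompact E) (𝓝 0) := by
  rcases subsingleton_or_nontrivial E with hE | hE
  · -- a trivial space is compact: the cocompact filter is `⊥`
    have : cocompact E = ⊥ := by
      haveI : CompactSpace E := ⟨Subsingleton.isCompact (s := (univ : Set E)) (subsingleton_univ)⟩
      exact cocompact_eq_bot
    rw [this]
    exact tendsto_bot
  rw [Metric.tendsto_nhds]
  intro ε hε
  set r : ℝ := ε / (2 * L + 2) with hr
  have hr0 : 0 < r := by positivity
  -- the energy of `v` on far balls of radius `r` is eventually below the threshold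
  set m : ℝ := (ε / 2) ^ 2 * (volume (ball (0 : E) r)).toReal with hm
  have hvol : 0 < (volume (ball (0 : E) r)).toReal :=
    ENNReal.toReal_pos (measure_ball_pos volume 0 hr0).ne' measure_ball_lt_top.ne
  have hm0 : 0 < m := by positivity
  have htail := (Metric.tendsto_nhds.1 (tendsto_setIntegral_ball_cocompact hint r)) m hm0
  filter_upwards [htail] with x₀ hx₀
  rw [dist_zero_right]
  by_contra hge
  rw [not_lt] at hge
  -- on `B(x₀, r)` the map stays above `ε/2`
  have hlow : ∀ x ∈ ball x₀ r, (ε / 2) ^ 2 ≤ ‖v x‖ ^ 2 := by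
    intro x hx
    have h1 : ‖v x₀ - v x‖ ≤ L * r := by
      calc ‖v x₀ - v x‖ = dist (v x₀) (v x) := (dist_eq_norm _ _).symm
        _ ≤ L * dist x₀ x := hL.dist_le_mul x₀ x
        _ ≤ L * r := by
            refine mul_le_mul_of_nonneg_left ?_ L.coe_nonneg
            rw [dist_comm]; exact (mem_ball.1 hx).le
    have h2 : (L : ℝ) * r ≤ ε / 2 := by
      rw [hr, mul_div_assoc']
      rw [div_le_div_iff₀ (by positivity) (by positivity)]
      nlinarith [L.coe_nonneg, hε]
    have h3 : ε / 2 ≤ ‖v x‖ := by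
      have := norm_sub_norm_le (v x₀) (v x)
      linarith
    exact pow_le_pow_left₀ (by positivity) h3 2
  have hI : m ≤ ∫ x in ball x₀ r, ‖v x‖ ^ 2 := by
    have h1 : ∫ _ in ball x₀ r, (ε / 2) ^ 2 ≤ ∫ x in ball x₀ r, ‖v x‖ ^ 2 :=
      setIntegral_mono_on (integrableOn_const measure_ball_lt_top.ne) hint.integrableOn
        measurableSet_ball hlow
    rw [setIntegral_const, smul_eq_mul] at h1
    have hv : volume.real (ball x₀ r) = (volume (ball (0 : E) r)).toReal := by
      rw [measureReal_def, Measure.addHaar_ball_center]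
    rw [hv] at h1
    rw [hm, mul_comm]
    exact h1
  have hI' : |(∫ x in ball x₀ r, ‖v x‖ ^ 2) - 0| < m := by simpa [Real.dist_eq] using hx₀
  rw [sub_zero, abs_of_nonneg (integral_nonneg fun x => sq_nonneg _)] at hI'
  linarith

end General

/-! ### The slice classes of the Hölder Euler solutions -/

section Slice

/-- **A `C^{1,γ}` finite-energy field on `ℝ³` vanishes at infinity** (`MemC1Holder γ v`: `C¹` with
bounded `v`, `Dv`; `HasFiniteEnergy v`: `∫⁻ ‖v‖ₑ² < ∞`): the gradient bound makes `v` Lipschitz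
and the energy bound makes `‖v‖²` integrable. This is the hypothesis "`u → 0` at infinity" of the
Biot–Savart representation `biotSavart_curl_eq_self` for the slices of a solution in the class
`IsHolderEulerSolution`. [folklore] -/
theorem MemC1Holder.tendsto_cocompact_of_hasFiniteEnergy {γ : ℝ≥0}
    {v : EuclideanSpace ℝ (Fin 3) → EuclideanSpace ℝ (Fin 3)} (hv : MemC1Holder γ v)
    (hE : HasFiniteEnergy v) : Tendsto v (cocompact (EuclideanSpace ℝ (Fin 3))) (𝓝 0) := by
  -- the gradient bound
  have hsup : FunctionSpaces.eSupNorm (iteratedFDeriv ℝ 1 v) < ∞ := hv.2.1 1 le_rfl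
  set S : ℝ≥0∞ := FunctionSpaces.eSupNorm (iteratedFDeriv ℝ 1 v) with hS
  have hD : ∀ x, ‖fderiv ℝ v x‖₊ ≤ S.toNNReal := fun x => by
    have h1 := FunctionSpaces.enorm_le_eSupNorm (iteratedFDeriv ℝ 1 v) x
    rw [← ofReal_norm, norm_iteratedFDeriv_one, ofReal_norm] at h1
    have h2 : (‖fderiv ℝ v x‖₊ : ℝ≥0∞) ≤ S := h1
    exact ENNReal.le_toNNReal_of_coe_le h2 hsup.ne
  have hLip : LipschitzWith S.toNNReal v :=
    lipschitzWith_of_nnnorm_fderiv_le (hv.1.differentiable one_ne_zero) hD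
  -- the energy bound
  have hint : Integrable fun x => ‖v x‖ ^ 2 := by
    have hm : AEStronglyMeasurable (fun x => ‖v x‖ ^ 2) volume :=
      (hv.1.continuous.norm.pow 2).aestronglyMeasurable
    refine ⟨hm, ?_⟩
    rw [hasFiniteIntegral_iff_enorm]
    have e : ∀ x, ‖‖v x‖ ^ 2‖ₑ = ‖v x‖ₑ ^ 2 := fun x => by
      rw [Real.enorm_eq_ofReal (sq_nonneg _), ← ofReal_norm, ENNReal.ofReal_pow (norm_nonneg _)]
    simp_rw [e]
    exact hE
  exact tendsto_cocompact_of_lipschitzWith_of_integrable_sq hLip hint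

end Slice

end Literature.Analysis.FluidPDE
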